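import Summits.ValiantsHypothesis.ValiantsHypothesis.Theorems.DefinabilityGapPatternCounts
import HarnessLib

/-!
# DefinabilityGap — random witness patterns: star-free patterns exist up to degree `≍ m²` (unconditional)

Route `route-ValiantsHypothesis-DefinabilityGap` (decomp-valiant, lens 5: hardness–randomness / PIT axis), supporting
`KIPlantedHitting` (stmt-ValiantsHypothesis-23547) and the degree profile behind `KIAnnihilatorCHDefinable`
(stmt-ValiantsHypothesis-23444). Source: decomp-valiant lens-5 g16, NOTE-g16 §3 (Lemma 3, crude form, and Theorem A).

MAIN THEOREM `kiPer_hits_of_count`: if `q(m)³ · (2t)^m < (m(m−1))^m` then NO nonzero polynomial of total degree `≤ t`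
— of any size, in all `q(m)³` coordinate variables — annihilates `G_m`. With Bertrand `q(m) ≤ 2(m² + 1)` this covers
every `t ≤ m(m−1)/4` once `m ≥ 34` (`kiPer_hits_quarter`; the tree's `kiPer_hits_lowDegree` reached `t < m/2`).

Proof = first moment over the `(m!)^{q³}` pattern choices (`exists_starFree`): a star (see `DefinabilityGapAlienExclusion`)
needs a host `d` and a column-to-block map `f`; for fixed `(d, f)` the bad patterns factor over blocks
(`DefinabilityGapPatternCounts.card_admissible_mul_le`), the sum over `f` is `∏_a R_a` with `Σ_a R_a ≤ 2·|supp κ₀|`, and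
AM–GM. Then `kiPer_hits_of_starFree`. 0 sorry; VP ≠ VNP untouched.
-/

set_option linter.dupNamespace false

noncomputable section

open MvPolynomial
open Literature.Computability.AlgebraicComplexity Literature.Computability.MetaComplexity
open Summit.ValiantsHypothesis.ValiantsHypothesis.Theorems.DefinabilityGapAffineRung
open Summit.ValiantsHypothesis.ValiantsHypothesis.Theorems.DefinabilityGapAlienExclusion
open Summit.ValiantsHypothesis.ValiantsHypothesis.Theorems.DefinabilityGapPatternCounts

namespace Summit.ValiantsHypothesis.ValiantsHypothesis.Theorems.DefinabilityGapRandomPatterns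

variable {m : ℕ}

/-! ## 1. Star-free pattern choices exist -/

/-- **First moment.** If `q(m)³ · (2·|supp κ₀|)^m < (m(m−1))^m` then some choice of one pattern per block is star-free
for `κ₀`. [this file] -/
theorem exists_starFree (κ₀ : (Fin 3 → Fin (qOf m)) →₀ ℕ)
    (hcount : qOf m ^ 3 * (2 * κ₀.support.card) ^ m < (m * (m - 1)) ^ m) :
    ∃ π : (Fin 3 → Fin (qOf m)) → Equiv.Perm (Fin m), ∀ d : Fin 3 → Fin (qOf m), ∃ a : Fin m,
      ∀ b : Fin 3 → Fin (qOf m), b ≠ d → κ₀ b ≠ 0 → cellEmb m b (π b a, a) ≠ cellEmb m d (π b a, a) := by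
  classical
  set S := κ₀.support with hS
  set s := S.card with hs
  -- the bad set and its cover
  set Bad : Finset ((Fin 3 → Fin (qOf m)) → Equiv.Perm (Fin m)) := Finset.univ.filter fun π =>
    ∃ d, ∀ a, ∃ b, b ≠ d ∧ κ₀ b ≠ 0 ∧ cellEmb m b (π b a, a) = cellEmb m d (π b a, a) with hBad
  set E : (Fin 3 → Fin (qOf m)) → (Fin m → (Fin 3 → Fin (qOf m))) →
      Finset ((Fin 3 → Fin (qOf m)) → Equiv.Perm (Fin m)) := fun d f => Fintype.piFinset (admissible d f) with hE
  have hcover : Bad ⊆ Finset.univ.biUnion fun d => (Fintype.piFinset fun _ : Fin m => S).biUnion fun f => E d f := by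
    intro π hπ
    obtain ⟨d, hd⟩ := (Finset.mem_filter.1 hπ).2
    choose f hf using hd
    refine Finset.mem_biUnion.2 ⟨d, Finset.mem_univ _, Finset.mem_biUnion.2 ⟨f, ?_, ?_⟩⟩
    · exact Fintype.mem_piFinset.2 fun a => Finsupp.mem_support_iff.2 (hf a).2.1
    · refine Fintype.mem_piFinset.2 fun b => Finset.mem_filter.2 ⟨Finset.mem_univ _, fun a hab => ?_⟩
      subst hab
      exact ⟨(hf a).1, (hf a).2.2⟩
  -- card of `E d f`, with the factor `(m-1)^m`
  have hE1 : ∀ d f, (E d f).card * (m - 1) ^ m ≤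
      Nat.factorial m ^ Fintype.card (Fin 3 → Fin (qOf m)) * ∏ a, rowShare (f a) d a := by
    intro d f
    have hcardE : (E d f).card = ∏ b, (admissible d f b).card := Fintype.card_piFinset _
    have hm_sum : ∑ b, (fiber f b).card = m := by
      have h := Finset.card_eq_sum_card_fiberwise (s := (Finset.univ : Finset (Fin m)))
        (t := (Finset.univ : Finset (Fin 3 → Fin (qOf m)))) (f := f) (fun _ _ => Finset.mem_univ _)
      rw [Finset.card_univ, Fintype.card_fin] at h
      exact h.symm
    have hpowsplit : (m - 1) ^ m = ∏ b, (m - 1) ^ (fiber f b).card := by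
      rw [Finset.prod_pow_eq_pow_sum, hm_sum]
    have hprodr : ∏ b, ∏ a ∈ fiber f b, rowShare b d a = ∏ a, rowShare (f a) d a := by
      rw [← Finset.prod_fiberwise Finset.univ f fun a => rowShare (f a) d a]
      refine Finset.prod_congr rfl fun b _ => Finset.prod_congr rfl fun a ha => ?_
      rw [(Finset.mem_filter.1 ha).2]
    rw [hcardE, hpowsplit, ← Finset.prod_mul_distrib, ← hprodr, ← Finset.card_univ, ← Finset.prod_const,
      ← Finset.prod_mul_distrib]
    exact Finset.prod_le_prod (fun _ _ => Nat.zero_le _) fun b _ => card_admissible_mul_le d f b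
  -- sum over `f`, then AM–GM
  have hE2 : ∀ d, (∑ f ∈ Fintype.piFinset fun _ : Fin m => S, (E d f).card) * ((m - 1) ^ m * m ^ m) ≤
      Nat.factorial m ^ Fintype.card (Fin 3 → Fin (qOf m)) * (2 * s) ^ m := by
    intro d
    have hR : ∑ a, ∑ b ∈ S, rowShare b d a ≤ 2 * s := by
      rw [Finset.sum_comm]
      have := Finset.sum_le_sum fun b (_ : b ∈ S) => sum_rowShare_le_two (m := m) b d
      refine this.trans ?_
      rw [Finset.sum_const, smul_eq_mul, mul_comm]
    calc (∑ f ∈ Fintype.piFinset fun _ : Fin m => S, (E d f).card) * ((m - 1) ^ m * m ^ m)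
        = (∑ f ∈ Fintype.piFinset fun _ : Fin m => S, (E d f).card * (m - 1) ^ m) * m ^ m := by
          rw [← mul_assoc, Finset.sum_mul]
      _ ≤ (∑ f ∈ Fintype.piFinset fun _ : Fin m => S,
            Nat.factorial m ^ Fintype.card (Fin 3 → Fin (qOf m)) * ∏ a, rowShare (f a) d a) * m ^ m :=
          Nat.mul_le_mul_right _ (Finset.sum_le_sum fun f _ => hE1 d f)
      _ = Nat.factorial m ^ Fintype.card (Fin 3 → Fin (qOf m)) * ((∏ a, ∑ b ∈ S, rowShare b d a) * m ^ m) := by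
          rw [← Finset.mul_sum, Finset.prod_univ_sum, mul_assoc]
      _ ≤ Nat.factorial m ^ Fintype.card (Fin 3 → Fin (qOf m)) * (∑ a, ∑ b ∈ S, rowShare b d a) ^ m :=
          Nat.mul_le_mul_left _ (prod_mul_pow_le_sum_pow _)
      _ ≤ Nat.factorial m ^ Fintype.card (Fin 3 → Fin (qOf m)) * (2 * s) ^ m :=
          Nat.mul_le_mul_left _ (Nat.pow_le_pow_left hR m)
  -- union bound over `d`
  have hq : Fintype.card (Fin 3 → Fin (qOf m)) = qOf m ^ 3 := by
    rw [Fintype.card_fun, Fintype.card_fin, Fintype.card_fin]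
  have hBadle : Bad.card * ((m - 1) ^ m * m ^ m) ≤
      qOf m ^ 3 * (Nat.factorial m ^ Fintype.card (Fin 3 → Fin (qOf m)) * (2 * s) ^ m) := by
    calc Bad.card * ((m - 1) ^ m * m ^ m)
        ≤ (∑ d, ∑ f ∈ Fintype.piFinset fun _ : Fin m => S, (E d f).card) * ((m - 1) ^ m * m ^ m) := by
          refine Nat.mul_le_mul_right _ ((Finset.card_le_card hcover).trans ?_)
          refine Finset.card_biUnion_le.trans (Finset.sum_le_sum fun d _ => Finset.card_biUnion_le)
      _ = ∑ d, (∑ f ∈ Fintype.piFinset fun _ : Fin m => S, (E d f).card) * ((m - 1) ^ m * m ^ m) :=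
          Finset.sum_mul _ _ _
      _ ≤ ∑ _d : Fin 3 → Fin (qOf m), Nat.factorial m ^ Fintype.card (Fin 3 → Fin (qOf m)) * (2 * s) ^ m :=
          Finset.sum_le_sum fun d _ => hE2 d
      _ = _ := by rw [Finset.sum_const, smul_eq_mul, Finset.card_univ, hq]
  -- compare with the number of all pattern choices
  have hΩ : Fintype.card ((Fin 3 → Fin (qOf m)) → Equiv.Perm (Fin m)) =
      Nat.factorial m ^ Fintype.card (Fin 3 → Fin (qOf m)) := by
    rw [Fintype.card_fun, Fintype.card_perm, Fintype.card_fin]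
  have hmm : (m - 1) ^ m * m ^ m = (m * (m - 1)) ^ m := by rw [← mul_pow, mul_comm]
  rw [hmm] at hBadle
  have hlt : Bad.card * (m * (m - 1)) ^ m <
      Nat.factorial m ^ Fintype.card (Fin 3 → Fin (qOf m)) * (m * (m - 1)) ^ m := by
    calc Bad.card * (m * (m - 1)) ^ m
        ≤ qOf m ^ 3 * (Nat.factorial m ^ Fintype.card (Fin 3 → Fin (qOf m)) * (2 * s) ^ m) := hBadle
      _ = Nat.factorial m ^ Fintype.card (Fin 3 → Fin (qOf m)) * (qOf m ^ 3 * (2 * s) ^ m) := by ring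
      _ < Nat.factorial m ^ Fintype.card (Fin 3 → Fin (qOf m)) * (m * (m - 1)) ^ m :=
          Nat.mul_lt_mul_of_pos_left hcount (pow_pos (Nat.factorial_pos m) _)
  have hBadlt : Bad.card < Fintype.card ((Fin 3 → Fin (qOf m)) → Equiv.Perm (Fin m)) := by
    rw [hΩ]; exact Nat.lt_of_mul_lt_mul_right hlt
  -- so some pattern choice is not bad
  have hne : Badᶜ.Nonempty := by
    rw [← Finset.card_pos, Finset.card_compl]
    omega
  obtain ⟨π, hπ⟩ := hne
  rw [Finset.mem_compl, hBad, Finset.mem_filter, not_and] at hπ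
  have hπ' := hπ (Finset.mem_univ _)
  push Not at hπ'
  refine ⟨π, fun d => ?_⟩
  obtain ⟨a, ha⟩ := hπ' d
  exact ⟨a, fun b hbd hb0 hcell => ha b hbd hb0 hcell⟩

/-! ## 2. Theorem A (crude form) -/

/-- `|supp κ| ≤ deg D` for a monomial `z^κ` of `D`. [folklore] -/
theorem card_support_le_totalDegree {D : MvPolynomial (Fin 3 → Fin (qOf m)) ℂ} {κ : (Fin 3 → Fin (qOf m)) →₀ ℕ}
    (hκ : κ ∈ D.support) : κ.support.card ≤ D.totalDegree := by
  refine le_trans ?_ (le_totalDegree hκ)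
  rw [Finsupp.sum, Finset.card_eq_sum_ones]
  exact Finset.sum_le_sum fun b hb => Nat.one_le_iff_ne_zero.2 (Finsupp.mem_support_iff.1 hb)

/-- **Theorem A (random witness patterns, crude first moment).** If `q(m)³ · (2t)^m < (m(m−1))^m` then every nonzero `D`
of total degree `≤ t` — of any size — satisfies `D ∘ G_m ≠ 0`. [this file] -/
theorem kiPer_hits_of_count {t : ℕ} (hcount : qOf m ^ 3 * (2 * t) ^ m < (m * (m - 1)) ^ m)
    (D : MvPolynomial (Fin 3 → Fin (qOf m)) ℂ) (hD : D ≠ 0) (hdeg : D.totalDegree ≤ t) :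
    MvPolynomial.bind₁ (kiPer m) D ≠ 0 := by
  classical
  obtain ⟨κ₀, hκ₀⟩ := Finset.nonempty_iff_ne_empty.2 (mt MvPolynomial.support_eq_empty.1 hD)
  have hs : κ₀.support.card ≤ t := (card_support_le_totalDegree hκ₀).trans hdeg
  have hcount' : qOf m ^ 3 * (2 * κ₀.support.card) ^ m < (m * (m - 1)) ^ m :=
    lt_of_le_of_lt (Nat.mul_le_mul_left _ (Nat.pow_le_pow_left (Nat.mul_le_mul_left 2 hs) m)) hcount
  obtain ⟨π, hπ⟩ := exists_starFree κ₀ hcount'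
  exact kiPer_hits_of_starFree D hκ₀ hπ

/-- Pointwise form: no annihilator of `G_m` has total degree `≤ t` when `q(m)³ (2t)^m < (m(m−1))^m`. [this file] -/
theorem totalDegree_gt_of_annihilator {t : ℕ} (hcount : qOf m ^ 3 * (2 * t) ^ m < (m * (m - 1)) ^ m)
    {D : MvPolynomial (Fin 3 → Fin (qOf m)) ℂ} (hD : D ≠ 0) (hann : MvPolynomial.bind₁ (kiPer m) D = 0) :
    t < D.totalDegree := by
  by_contra h
  exact kiPer_hits_of_count hcount D hD (not_lt.1 h) hann

/-! ## 3. The explicit range `deg D ≤ m(m−1)/4` for `m ≥ 34` -/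

/-- `q(m) ≤ 2(m² + 1)` (Bertrand). [folklore] -/
theorem qOf_le (m : ℕ) : qOf m ≤ 2 * (m * m + 1) := leastPrimeGe_le _ (Nat.succ_ne_zero _)

/-- `8 (m² + 1)³ < 2^m` for `m ≥ 34`. [folklore] -/
theorem eight_mul_cube_lt_two_pow {m : ℕ} (hm : 34 ≤ m) : 8 * (m * m + 1) ^ 3 < 2 ^ m := by
  induction m, hm using Nat.le_induction with
  | base => norm_num
  | succ n hn ih =>
    have h5 : 5 * ((n + 1) * (n + 1) + 1) ≤ 6 * (n * n + 1) := by nlinarith [Nat.mul_le_mul_right n hn]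
    have h5c : 125 * ((n + 1) * (n + 1) + 1) ^ 3 ≤ 216 * (n * n + 1) ^ 3 := by
      have h := Nat.pow_le_pow_left h5 3
      rw [mul_pow, mul_pow] at h
      norm_num at h
      exact h
    have h2 : 2 ^ (n + 1) = 2 * 2 ^ n := by rw [pow_succ, mul_comm]
    rw [h2]
    generalize ((n + 1) * (n + 1) + 1) ^ 3 = X at h5c ⊢
    generalize (n * n + 1) ^ 3 = Y at h5c ih
    generalize 2 ^ n = Z at ih ⊢
    omega

/-- The counting hypothesis of `kiPer_hits_of_count` holds for `4t ≤ m(m−1)`, `m ≥ 34`. [this file] -/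
theorem count_of_quarter (hm : 34 ≤ m) {t : ℕ} (ht : 4 * t ≤ m * (m - 1)) :
    qOf m ^ 3 * (2 * t) ^ m < (m * (m - 1)) ^ m := by
  have hq : qOf m ^ 3 < 2 ^ m := by
    refine lt_of_le_of_lt ?_ (eight_mul_cube_lt_two_pow hm)
    have h := Nat.pow_le_pow_left (qOf_le m) 3
    rw [mul_pow] at h
    norm_num at h
    exact h
  have h4 : (2 * t * 2) ^ m ≤ (m * (m - 1)) ^ m := Nat.pow_le_pow_left (by omega) m
  have hpos : 0 < (m * (m - 1)) ^ m := pow_pos (Nat.mul_pos (by omega) (by omega)) m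
  have key : qOf m ^ 3 * (2 * t) ^ m * 2 ^ m < (m * (m - 1)) ^ m * 2 ^ m := by
    calc qOf m ^ 3 * (2 * t) ^ m * 2 ^ m = qOf m ^ 3 * (2 * t * 2) ^ m := by rw [mul_assoc, ← mul_pow]
      _ ≤ qOf m ^ 3 * (m * (m - 1)) ^ m := Nat.mul_le_mul_left _ h4
      _ < 2 ^ m * (m * (m - 1)) ^ m := mul_lt_mul_of_pos_right hq hpos
      _ = (m * (m - 1)) ^ m * 2 ^ m := mul_comm _ _
  exact Nat.lt_of_mul_lt_mul_right key

/-- **Corollary (degree up to `m(m−1)/4`).** For `m ≥ 34`, no nonzero `D` with `4 · deg D ≤ m(m−1)` — of any size —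
annihilates `G_m` (the tree's earlier unconditional range was `deg D < m/2`). [this file] -/
theorem kiPer_hits_quarter (hm : 34 ≤ m) (D : MvPolynomial (Fin 3 → Fin (qOf m)) ℂ) (hD : D ≠ 0)
    (hdeg : 4 * D.totalDegree ≤ m * (m - 1)) : MvPolynomial.bind₁ (kiPer m) D ≠ 0 :=
  kiPer_hits_of_count (count_of_quarter hm hdeg) D hD le_rfl

end Summit.ValiantsHypothesis.ValiantsHypothesis.Theorems.DefinabilityGapRandomPatterns
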